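import Summits.HodgeConjecture.CorCM.TwoGroupExtraspecialTable
import HarnessLib

/-!
# The class-two table on `𝔽₂³ × 𝔽₂²`: groups of order `32` with a central four-group `V = ⟨c, t⟩` containing all squares

COR-CM (cell `pub-hodgecm2`), binder seat b04 (gen 36), count-neutral own lane «Galois-CM-type classification».  KERNEL ONLY:
theorems; no definition, no named fact, no `sorry`.  Pure group theory for the ORDER-`32` BASE programme (A7-JUNCTION gen-36
addendum §E): the uniform TABLE MODEL of every group `G` of order `32` with two commuting central involutions `c ≠ t` and three
elements `x₁, x₂, x₃` independent modulo `V = {1, c, t, ct}` whose squares and commutators lie in `V`: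
`xᵢ² = c^{αᵢ} t^{βᵢ}`, `x₂x₁ = x₁x₂ · c^{γ₁}t^{δ₁}`, `x₃x₁ = x₁x₃ · c^{γ₂}t^{δ₂}`, `x₃x₂ = x₂x₃ · c^{γ₃}t^{δ₃}` (twelve bits).  Then the
word map `(a₁,a₂,a₃,d₁,d₂) ↦ x₁^{a₁} x₂^{a₂} x₃^{a₃} c^{d₁} t^{d₂}` inverts to `e : G ≃ 𝔽₂⁵` carrying the multiplication to the
bilinear-cocycle law `(a;d)(a';d') = (a + a'; d + d' + β(a,a'))`,
`β(a,a') = (Σ αᵢaᵢa'ᵢ + γ₁a₂a'₁ + γ₂a₃a'₁ + γ₃a₃a'₂, Σ βᵢaᵢa'ᵢ + δ₁a₂a'₁ + δ₂a₃a'₁ + δ₃a₃a'₂)` (`exists_table_classtwo`).  This is the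
whole world «`[K:ℚ] = 32`, a central involution `t ≠ c`, all squares in `{1,c,t,ct}`» of `CorCM/GaloisThirtyTwoQuotientSixteen`
(first alternative of the pulled-back GOOD16 dichotomy); `CorCM/GaloisThirtyTwoClassTwoCertificate` decides ONE `(T₀, D)` certificate on
this table uniformly in the `2¹¹` parameters with `α₁ = 0`.

* `swap_tail`, `sq_tail` — the collection rules `xⱼ^a (xᵢ^b R) = xᵢ^b (xⱼ^a (c^{γab} (t^{δab} R)))`, `x^a (x^b R) = x^{a+b} (c^{αab} (t^{βab} R))`.
* `classtwo_words_mul` — the word multiplication formula.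
* **`exists_table_classtwo`** — the table model (unit and left-inverse identities of the law proved symbolically, component by
  component, by `decide` over the `≤ 2¹⁴` relevant bits).

## References

* [Rotman1995] J. J. Rotman, *An Introduction to the Theory of Groups*, 4th ed., GTM 148, Ch. 5 (collection in nilpotent groups, Thm. 5.46).
* [Shimura1998] G. Shimura, *Abelian Varieties with Complex Multiplication and Modular Functions*, §8.2 (where the tables are used).
-/

namespace Summit.HodgeConjecture.CorCM.GaloisModels.ClassTwo

open Summit.HodgeConjecture.CorCM.GaloisTableLaws
open Summit.HodgeConjecture.CorCM.GaloisModels.FrattiniTwo (invol_pow_add exists_table_equiv_of_words_inv)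

variable {G : Type*} [Group G]

/-! ## §1 Collection rules with a tail -/

/-- **Swap rule.**  `y x = x y (c^γ t^δ)` ⟹ `yᵃ (xᵇ R) = xᵇ (yᵃ (c^{γab} (t^{δab} R)))` for `a, b ∈ 𝔽₂`. [folklore] -/
theorem swap_tail {c t x y : G} {γ δ : ZMod 2} (hyx : y * x = x * y * (c ^ γ.val * t ^ δ.val)) (a b : ZMod 2) (R : G) :
    y ^ a.val * (x ^ b.val * R) = x ^ b.val * (y ^ a.val * (c ^ (γ * (a * b)).val * (t ^ (δ * (a * b)).val * R))) := by
  have hv0 : (0 : ZMod 2).val = 0 := rfl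
  have hv1 : (1 : ZMod 2).val = 1 := rfl
  rcases zmod2_cases a with rfl | rfl <;> rcases zmod2_cases b with rfl | rfl <;>
    simp only [hv0, hv1, pow_zero, pow_one, one_mul, mul_one, mul_zero]
  rw [← mul_assoc y x R, hyx]
  simp only [mul_assoc]

/-- **Square rule.**  `x x = c^α t^β` ⟹ `xᵃ (xᵇ R) = x^{a+b} (c^{αab} (t^{βab} R))` for `a, b ∈ 𝔽₂`. [folklore] -/
theorem sq_tail {c t x : G} {α β : ZMod 2} (hxx : x * x = c ^ α.val * t ^ β.val) (a b : ZMod 2) (R : G) :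
    x ^ a.val * (x ^ b.val * R) = x ^ (a + b).val * (c ^ (α * (a * b)).val * (t ^ (β * (a * b)).val * R)) := by
  have hv0 : (0 : ZMod 2).val = 0 := rfl
  have hv1 : (1 : ZMod 2).val = 1 := rfl
  have h11 : ((1 : ZMod 2) + 1).val = 0 := rfl
  rcases zmod2_cases a with rfl | rfl <;> rcases zmod2_cases b with rfl | rfl <;>
    simp only [hv0, hv1, h11, add_zero, zero_add, pow_zero, pow_one, one_mul, mul_one, mul_zero]
  rw [← mul_assoc x x R, hxx]
  simp only [mul_assoc]

/-- Powers of a central element pass a factor: `c^u (g R) = g (c^u R)`. [folklore] -/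
theorem central_pow_tail {c : G} (hcen : ∀ g : G, c * g = g * c) (u : ℕ) (g R : G) :
    c ^ u * (g * R) = g * (c ^ u * R) :=
  ((show Commute c g from hcen g).pow_left u).left_comm R

/-- Two `𝔽₂`-powers of an involution merge, with a tail: `c^u (c^v R) = c^{u+v} R`. [folklore] -/
theorem invol_pow_add_tail {c : G} (hcc : c * c = 1) (u v : ZMod 2) (R : G) :
    c ^ u.val * (c ^ v.val * R) = c ^ (u + v).val * R := by
  rw [← mul_assoc, ← invol_pow_add hcc]

/-! ## §2 The word multiplication formula -/

/-- **Multiplication of the words `x₁^{a₁} x₂^{a₂} x₃^{a₃} c^{d₁} t^{d₂}`** (`aᵢ, dⱼ ∈ 𝔽₂`) under the class-two relations: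
the exponents add and the `V`-part picks up the bilinear cocycle `β(a, a')`. [cite: Rotman1995, Ch. 5] -/
theorem classtwo_words_mul {c t x₁ x₂ x₃ : G} (hcc : c * c = 1) (htt : t * t = 1) (hcen : ∀ g : G, c * g = g * c)
    (htcen : ∀ g : G, t * g = g * t) (α₁ β₁ α₂ β₂ α₃ β₃ γ₁ δ₁ γ₂ δ₂ γ₃ δ₃ : ZMod 2)
    (hq1 : x₁ * x₁ = c ^ α₁.val * t ^ β₁.val) (hq2 : x₂ * x₂ = c ^ α₂.val * t ^ β₂.val)
    (hq3 : x₃ * x₃ = c ^ α₃.val * t ^ β₃.val) (hk21 : x₂ * x₁ = x₁ * x₂ * (c ^ γ₁.val * t ^ δ₁.val))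
    (hk31 : x₃ * x₁ = x₁ * x₃ * (c ^ γ₂.val * t ^ δ₂.val)) (hk32 : x₃ * x₂ = x₂ * x₃ * (c ^ γ₃.val * t ^ δ₃.val))
    (a₁ a₂ a₃ d₁ d₂ b₁ b₂ b₃ e₁ e₂ : ZMod 2) :
    x₁ ^ a₁.val * x₂ ^ a₂.val * x₃ ^ a₃.val * c ^ d₁.val * t ^ d₂.val *
        (x₁ ^ b₁.val * x₂ ^ b₂.val * x₃ ^ b₃.val * c ^ e₁.val * t ^ e₂.val) =
      x₁ ^ (a₁ + b₁).val * x₂ ^ (a₂ + b₂).val * x₃ ^ (a₃ + b₃).val *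
        c ^ (d₁ + e₁ + (α₁ * (a₁ * b₁) + α₂ * (a₂ * b₂) + α₃ * (a₃ * b₃) + γ₁ * (a₂ * b₁) + γ₂ * (a₃ * b₁) +
          γ₃ * (a₃ * b₂))).val *
        t ^ (d₂ + e₂ + (β₁ * (a₁ * b₁) + β₂ * (a₂ * b₂) + β₃ * (a₃ * b₃) + δ₁ * (a₂ * b₁) + δ₂ * (a₃ * b₁) +
          δ₃ * (a₃ * b₂))).val := by
  -- oriented collection rules: swaps and squares create `c`/`t`-powers, which then travel right and merge
  have S21 := swap_tail hk21
  have S31 := swap_tail hk31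
  have S32 := swap_tail hk32
  have Q1 := sq_tail hq1
  have Q2 := sq_tail hq2
  have Q3 := sq_tail hq3
  have C1 : ∀ (u : ZMod 2) (n : ℕ) (R : G), c ^ u.val * (x₁ ^ n * R) = x₁ ^ n * (c ^ u.val * R) :=
    fun u n R => central_pow_tail hcen _ _ _
  have C2 : ∀ (u : ZMod 2) (n : ℕ) (R : G), c ^ u.val * (x₂ ^ n * R) = x₂ ^ n * (c ^ u.val * R) :=
    fun u n R => central_pow_tail hcen _ _ _
  have C3 : ∀ (u : ZMod 2) (n : ℕ) (R : G), c ^ u.val * (x₃ ^ n * R) = x₃ ^ n * (c ^ u.val * R) :=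
    fun u n R => central_pow_tail hcen _ _ _
  have T1 : ∀ (u : ZMod 2) (n : ℕ) (R : G), t ^ u.val * (x₁ ^ n * R) = x₁ ^ n * (t ^ u.val * R) :=
    fun u n R => central_pow_tail htcen _ _ _
  have T2 : ∀ (u : ZMod 2) (n : ℕ) (R : G), t ^ u.val * (x₂ ^ n * R) = x₂ ^ n * (t ^ u.val * R) :=
    fun u n R => central_pow_tail htcen _ _ _
  have T3 : ∀ (u : ZMod 2) (n : ℕ) (R : G), t ^ u.val * (x₃ ^ n * R) = x₃ ^ n * (t ^ u.val * R) :=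
    fun u n R => central_pow_tail htcen _ _ _
  have TC : ∀ (u v : ZMod 2) (R : G), t ^ u.val * (c ^ v.val * R) = c ^ v.val * (t ^ u.val * R) :=
    fun u v R => central_pow_tail htcen _ _ _
  have CC := invol_pow_add_tail hcc
  have TT' : ∀ u v : ZMod 2, t ^ u.val * t ^ v.val = t ^ (u + v).val := fun u v => (invol_pow_add htt u v).symm
  simp only [mul_assoc]
  simp only [S21, S31, S32, Q1, Q2, Q3, C1, C2, C3, T1, T2, T3, TC, CC, TT']
  ring_nf

/-! ## §3 The table model -/

variable [Finite G]

/-- **Table model for the class-two configuration.**  `|G| = 32`; `c ≠ t` commuting central involutions (`c, t ≠ 1`);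
`x₁, x₂, x₃` with `xᵢ² = c^{αᵢ}t^{βᵢ}`, `x₂x₁ = x₁x₂(c^{γ₁}t^{δ₁})`, `x₃x₁ = x₁x₃(c^{γ₂}t^{δ₂})`, `x₃x₂ = x₂x₃(c^{γ₃}t^{δ₃})`,
INDEPENDENT modulo `V = ⟨c, t⟩` in the word form `x₁ c^{d₁}t^{d₂} ≠ 1`, `x₁^a x₂ c^{d₁}t^{d₂} ≠ 1`, `x₁^a x₂^b x₃ c^{d₁}t^{d₂} ≠ 1`;
`mul` an operation on `𝔽₂⁵` agreeing with the bilinear-cocycle law.  Then the word map inverts to a table model `e : G ≃ 𝔽₂⁵`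
with `e(gh) = mul (e g) (e h)` and `e (x₁^{a₁}x₂^{a₂}x₃^{a₃}c^{d₁}t^{d₂}) = (a₁,a₂,a₃,d₁,d₂)` (so `e c = (0,0,0,1,0)`, `e 1 = 0`).
[cite: Rotman1995, Ch. 5] -/
theorem exists_table_classtwo {c t x₁ x₂ x₃ : G} (hcc : c * c = 1) (htt : t * t = 1) (hc1 : c ≠ 1) (ht1 : t ≠ 1)
    (htc : t ≠ c) (hcen : ∀ g : G, c * g = g * c) (htcen : ∀ g : G, t * g = g * t)
    (α₁ β₁ α₂ β₂ α₃ β₃ γ₁ δ₁ γ₂ δ₂ γ₃ δ₃ : ZMod 2)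
    (hq1 : x₁ * x₁ = c ^ α₁.val * t ^ β₁.val) (hq2 : x₂ * x₂ = c ^ α₂.val * t ^ β₂.val)
    (hq3 : x₃ * x₃ = c ^ α₃.val * t ^ β₃.val) (hk21 : x₂ * x₁ = x₁ * x₂ * (c ^ γ₁.val * t ^ δ₁.val))
    (hk31 : x₃ * x₁ = x₁ * x₃ * (c ^ γ₂.val * t ^ δ₂.val)) (hk32 : x₃ * x₂ = x₂ * x₃ * (c ^ γ₃.val * t ^ δ₃.val))
    (h1 : ∀ d₁ d₂ : ZMod 2, x₁ * c ^ d₁.val * t ^ d₂.val ≠ 1)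
    (h2 : ∀ a d₁ d₂ : ZMod 2, x₁ ^ a.val * x₂ * c ^ d₁.val * t ^ d₂.val ≠ 1)
    (h3 : ∀ a b d₁ d₂ : ZMod 2, x₁ ^ a.val * x₂ ^ b.val * x₃ * c ^ d₁.val * t ^ d₂.val ≠ 1)
    (hcard : Nat.card G = 32)
    (mul : ZMod 2 × ZMod 2 × ZMod 2 × ZMod 2 × ZMod 2 → ZMod 2 × ZMod 2 × ZMod 2 × ZMod 2 × ZMod 2 →
      ZMod 2 × ZMod 2 × ZMod 2 × ZMod 2 × ZMod 2)
    (hm : ∀ p q : ZMod 2 × ZMod 2 × ZMod 2 × ZMod 2 × ZMod 2, mul p q =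
      (p.1 + q.1, p.2.1 + q.2.1, p.2.2.1 + q.2.2.1,
        p.2.2.2.1 + q.2.2.2.1 + (α₁ * (p.1 * q.1) + α₂ * (p.2.1 * q.2.1) + α₃ * (p.2.2.1 * q.2.2.1) +
          γ₁ * (p.2.1 * q.1) + γ₂ * (p.2.2.1 * q.1) + γ₃ * (p.2.2.1 * q.2.1)),
        p.2.2.2.2 + q.2.2.2.2 + (β₁ * (p.1 * q.1) + β₂ * (p.2.1 * q.2.1) + β₃ * (p.2.2.1 * q.2.2.1) +
          δ₁ * (p.2.1 * q.1) + δ₂ * (p.2.2.1 * q.1) + δ₃ * (p.2.2.1 * q.2.1)))) :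
    ∃ e : G ≃ ZMod 2 × ZMod 2 × ZMod 2 × ZMod 2 × ZMod 2, (∀ g h : G, e (g * h) = mul (e g) (e h)) ∧
      ∀ p : ZMod 2 × ZMod 2 × ZMod 2 × ZMod 2 × ZMod 2,
        e (x₁ ^ p.1.val * x₂ ^ p.2.1.val * x₃ ^ p.2.2.1.val * c ^ p.2.2.2.1.val * t ^ p.2.2.2.2.val) = p := by
  have hv0 : (0 : ZMod 2).val = 0 := rfl
  have hv1 : (1 : ZMod 2).val = 1 := rfl
  set f : ZMod 2 × ZMod 2 × ZMod 2 × ZMod 2 × ZMod 2 → G :=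
    fun p => x₁ ^ p.1.val * x₂ ^ p.2.1.val * x₃ ^ p.2.2.1.val * c ^ p.2.2.2.1.val * t ^ p.2.2.2.2.val with hf_def
  have hf : ∀ p q, f (mul p q) = f p * f q := by
    rintro ⟨a₁, a₂, a₃, d₁, d₂⟩ ⟨b₁, b₂, b₃, e₁, e₂⟩
    rw [hm]
    simp only [hf_def]
    exact (classtwo_words_mul hcc htt hcen htcen α₁ β₁ α₂ β₂ α₃ β₃ γ₁ δ₁ γ₂ δ₂ γ₃ δ₃ hq1 hq2 hq3 hk21 hk31 hk32
      a₁ a₂ a₃ d₁ d₂ b₁ b₂ b₃ e₁ e₂).symm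
  have hker : ∀ p, f p = 1 → p = (0, 0, 0, 0, 0) := by
    rintro ⟨a₁, a₂, a₃, d₁, d₂⟩ h
    simp only [hf_def] at h
    rcases zmod2_cases a₃ with rfl | rfl
    · rcases zmod2_cases a₂ with rfl | rfl
      · rcases zmod2_cases a₁ with rfl | rfl
        · simp only [hv0, pow_zero, one_mul] at h
          rcases zmod2_cases d₁ with rfl | rfl <;> rcases zmod2_cases d₂ with rfl | rfl
          · rfl
          · exfalso; rw [hv0, hv1, pow_zero, pow_one, one_mul] at h; exact ht1 h
          · exfalso; rw [hv0, hv1, pow_zero, pow_one, mul_one] at h; exact hc1 h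
          · exfalso; rw [hv1, pow_one, pow_one] at h
            exact htc ((eq_inv_of_mul_eq_one_right h).trans (inv_eq_of_mul_eq_one_right hcc))
        · exfalso
          rw [hv0, hv1, pow_one, pow_zero, pow_zero, mul_one, mul_one] at h
          exact h1 d₁ d₂ h
      · exfalso
        rw [hv0, hv1, pow_one, pow_zero, mul_one] at h
        exact h2 a₁ d₁ d₂ h
    · exfalso
      rw [hv1, pow_one] at h
      exact h3 a₁ a₂ d₁ d₂ h
  have hfo : f (0, 0, 0, 0, 0) = 1 := by simp only [hf_def, hv0, pow_zero, mul_one]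
  -- unit and left-inverse identities of the law, symbolically (component by component)
  have ho : ∀ p : ZMod 2 × ZMod 2 × ZMod 2 × ZMod 2 × ZMod 2, mul p (0, 0, 0, 0, 0) = p := by
    rintro ⟨a₁, a₂, a₃, d₁, d₂⟩
    rw [hm]
    simp only [add_zero, mul_zero]
  have h2 : (2 : ZMod 2) = 0 := by decide
  have id1 : ∀ a b : ZMod 2, a + (a + b) = b := fun a b => by linear_combination a * h2
  have id4 : ∀ α₁ α₂ α₃ γ₁ γ₂ γ₃ a₁ a₂ a₃ b₁ b₂ b₃ d₁ e₁ : ZMod 2,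
      d₁ + (α₁ * (a₁ * a₁) + α₂ * (a₂ * a₂) + α₃ * (a₃ * a₃) + γ₁ * (a₂ * a₁) + γ₂ * (a₃ * a₁) + γ₃ * (a₃ * a₂)) +
          (d₁ + e₁ + (α₁ * (a₁ * b₁) + α₂ * (a₂ * b₂) + α₃ * (a₃ * b₃) + γ₁ * (a₂ * b₁) + γ₂ * (a₃ * b₁) +
            γ₃ * (a₃ * b₂))) +
        (α₁ * (a₁ * (a₁ + b₁)) + α₂ * (a₂ * (a₂ + b₂)) + α₃ * (a₃ * (a₃ + b₃)) + γ₁ * (a₂ * (a₁ + b₁)) +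
          γ₂ * (a₃ * (a₁ + b₁)) + γ₃ * (a₃ * (a₂ + b₂))) = e₁ := by
    intro α₁ α₂ α₃ γ₁ γ₂ γ₃ a₁ a₂ a₃ b₁ b₂ b₃ d₁ e₁
    linear_combination (d₁ + α₁ * (a₁ * a₁) + α₂ * (a₂ * a₂) + α₃ * (a₃ * a₃) + γ₁ * (a₂ * a₁) + γ₂ * (a₃ * a₁) +
      γ₃ * (a₃ * a₂) + α₁ * (a₁ * b₁) + α₂ * (a₂ * b₂) + α₃ * (a₃ * b₃) + γ₁ * (a₂ * b₁) + γ₂ * (a₃ * b₁) +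
      γ₃ * (a₃ * b₂)) * h2
  have hlinv : ∀ p q : ZMod 2 × ZMod 2 × ZMod 2 × ZMod 2 × ZMod 2,
      mul (p.1, p.2.1, p.2.2.1,
        p.2.2.2.1 + (α₁ * (p.1 * p.1) + α₂ * (p.2.1 * p.2.1) + α₃ * (p.2.2.1 * p.2.2.1) + γ₁ * (p.2.1 * p.1) +
          γ₂ * (p.2.2.1 * p.1) + γ₃ * (p.2.2.1 * p.2.1)),
        p.2.2.2.2 + (β₁ * (p.1 * p.1) + β₂ * (p.2.1 * p.2.1) + β₃ * (p.2.2.1 * p.2.2.1) + δ₁ * (p.2.1 * p.1) +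
          δ₂ * (p.2.2.1 * p.1) + δ₃ * (p.2.2.1 * p.2.1))) (mul p q) = q := by
    rintro ⟨a₁, a₂, a₃, d₁, d₂⟩ ⟨b₁, b₂, b₃, e₁, e₂⟩
    rw [hm, hm]
    simp only [id1, id4]
  obtain ⟨e, he, hef⟩ := exists_table_equiv_of_words_inv mul (0, 0, 0, 0, 0) _ f hf hker hfo ho hlinv
    (by rw [hcard]; simp [ZMod.card])
  exact ⟨e, he, fun p => hef p⟩

end Summit.HodgeConjecture.CorCM.GaloisModels.ClassTwo
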